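import Summits.CriticalPhenomena.SAWScalingLimit.Theorems.SAWDefectDecoherenceMassRatioMirrorGlue

/-!
# Crux `SAWDefectDecoherence.MassRatio` (stmt-CriticalPhenomena-8550) — line
# `mirror-doubling-endpoint-restriction`, lead c1: skeleton over the LANDED vocabulary and glue

State (2026-08-16, lead `prover-line-stmt-CriticalPhenomena-8550-c1-0`, cycle 1b):

* LANDED `Theorems/SAWDefectDecoherenceMassRatioMirrorDefs.lean` (p100906): `ball`, `double`, `scaleR`,
  `rhoCap`, `cEdge`, `aEdge`, `canonDisc`, predicates `InteriorHarnack s`, `EndpointRestriction t`,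
  `CanonicalRestriction t`, `RatioMixing D ρ Λ m a b`; `canonical_pos`, `aEdge_mem_boundary`,
  `cEdge_mem_boundary`, `cEdge_subset_double` (non-vacuity of the canonical family); reuses
  `FlatRoot.Frame`, `FlatRoot.MassRatioAt`, `Renewal.Z`.
* LANDED `Theorems/SAWDefectDecoherenceMassRatioMirrorGlue.lean`: `massRatio_of_mirrorStubs :
  CanonicalRestriction (3/4) → (∀ datum, RatioMixing …) → InteriorHarnack 0 → MassRatio` (registered
  sub-goal) + `Glue.endpointRestriction_of_canonical` (every `t ≥ 0`), `Glue.massRatioAt_of` (every split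
  `s + t`), `Glue.Z_mono`.
* OPEN (registered additively by `stub-add`; `sorry` only here): `stub_canonicalRestriction` (hardest,
  held by the lead), `stub_ratioMixing`, `stub_interiorHarnack` (wave).

`lean check`: rc 0, 3 sorries (the three stubs), `MassRatio_of` concludes the crux by name. The planner's
full skeleton with docstrings and the falsifier is `Lines/mirror_doubling_endpoint_restriction.lean`.
-/

namespace Summit.CriticalPhenomena.SAWScalingLimit.Cruxes.MassRatio.MirrorDoublingEndpointRestriction

open Literature.Probability.LatticeModels Literature.Probability.RandomPlanarGeometry
open Literature.Probability.RandomPlanarGeometry.SAW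
open Summit.CriticalPhenomena.SAWScalingLimit.Theses.SAWDefectDecoherence
open Summit.CriticalPhenomena.SAWScalingLimit.Theorems.MassRatio.Mirror

noncomputable section

/-! ## Stubs (registered; `sorry` only here) -/

/-- **Stub 1 (hardest) — canonical restriction at the filed cut**: `∃ c₀ > 0, ∀ R ≥ 1,
c₀ R^{-3/4} Z_{H_R ∪ Ball_R}(a_R → c₀) ≤ Z_{H_R}(a_R → c₀)` in the explicit doubled half-disc family
(`canonDisc R`, radius `4R`, root door at distance `2R`, phantom ball of radius `R`). Predicted ratio
`R^{-25/48}` (slack `11/48`); simple-random-walk value `R^{-1}` (fails the cut): the crux's sharp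
exponent content in canonical, frame-free, measurable form. OPEN (no RSW/FKG/domain-Markov for SAW;
rigorous inputs are exit-summed). -/
theorem stub_canonicalRestriction : CanonicalRestriction (3 / 4) := by
  sorry

/-- **Stub 2 — ratio mixing** (frame avoidance ratio ≥ c · canonical avoidance ratio at `R = ⌊ρ'/δ⌋`,
exponent `0`; SAW boundary quasi-multiplicativity at the endpoint). OPEN. -/
theorem stub_ratioMixing : ∀ (D : DobrushinDomain) (ρ : ℝ) (Λ : ℝ → Finset HexVertex) (m : ℝ → ℤ) (a b : ℝ → Sym2 HexVertex), RatioMixing D ρ Λ m a b := by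
  sorry

/-- **Stub 3 — interior Harnack in the doubled domain at exponent exactly `0`**
(`δ² Σ_{e∈K} Z_{Λ⁺}(a→e) ≤ C · Z_{Λ⁺}(a→b_δ)` eventually). OPEN at every exponent (pointwise lower
bound at one bulk point; uses exhaustion). -/
theorem stub_interiorHarnack : InteriorHarnack 0 := by
  sorry

/-! ## Composition: the line concludes the crux by name through the landed glue -/

/-- **The line concludes the crux** from its three stubs via `Mirror.massRatio_of_mirrorStubs`. -/
theorem MassRatio_of : MassRatio :=
  massRatio_of_mirrorStubs stub_canonicalRestriction stub_ratioMixing stub_interiorHarnack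

end

end Summit.CriticalPhenomena.SAWScalingLimit.Cruxes.MassRatio.MirrorDoublingEndpointRestriction
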